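import Summits.BirchSwinnertonDyer.Rank1Residual.X11b.BDPRouteUpperLinksInert
import Literature.NumberTheory.EllipticCurves.QuadraticTwistLocalPolynomialTwoProofs
import HarnessLib

/-!
# Class X11b, route "BDP + converse-theorem engine + Kolyvagin": the Shimura links' Tamagawa bookkeeping at the prime `2` INERT in `K″` (cell `b2b-bsdres`, sub-cell `multr1-p2`, gen 9)

HONEST FRAMING (verbatim, cell `b2b-bsdres`): the goal of the cell is to DELETE the
COMBINATION-SHAPED residual classes for ALL analytic-rank `≤ 1` curves over `ℚ` — "full BSD
formula for every rank `≤ 1` curve in class `C`" assembled STRICTLY from published theorems — so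
that the rank-`≤ 1` remainder becomes exactly the CONSTRUCTION-SHAPED classes, which are TYPED
(missing-input Props), NOT attempted; this is not "finishing BSD". Research route `p2` for class
X11b; no claim beyond the stated class; nothing booked; X11b stays CONSTRUCTION-SHAPED. Theorems
only (no definition, no new named fact).

## What this file does

`BDPRouteUpperLinksInert.lean` / `BDPRouteUpperLinksField.lean` (gen 9) prove the numeric Tamagawa
condition of the two Shimura-curve shapes for a field `K″` of Jetchev–Skinner–Wan §7.4.2 type whose
inert set `S` (= `N⁻`) consists of ODD primes. In the census (`HOME/b2b-bsdres-multr1-p2/shcensus/`)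
`17 223` of the `41 174` pairs of the sub-shape (T2β)∖(T2α) have `ℓ = 2` among the offending primes
(split multiplicative at `2` with `p ∣ ord_2 Δ_min`), so `2` must be put into `N⁻`: `2` INERT in
`K″`, i.e. `d_K ≡ 5 (mod 8)`. This file does the `2`-adic local step with the tree's unramified
`2`-adic twist model `X'_c` of `X^{(1+4c)}` (`QuadraticTwistLocalPolynomialTwoProofs`: minimal when
`X` is, `Δ(X'_c) = d⁶Δ(X)`, split and non-split EXCHANGED iff `c̄ ∉ ℘(𝔽₂) = {0}`, i.e. iff `c` is
odd, i.e. iff `d = 1 + 4c ≡ 5 (mod 8)`):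

* `padicValInt_minimalDiscriminantInt_twist_eq_of_mod_eight` — `ord_2 Δ_min(E^{d_K}) = ord_2 Δ_min(E)`;
* `padicValNat_localTamagawaNumber_add_twist_le_of_inert_two` — `E` multiplicative at `2`,
  `d_K ≡ 5 (mod 8)`, `p ≥ 5`: `v_p c_2(E) + v_p c_2(E^{d_K}) ≤ v_p(ord_2 Δ_min(E))`;
* `mult_twist_of_mod_eight`, `ram_twist_of_inert_witness_two` — multiplicativity and a (ram)
  witness at `2` pass to the twist.

The all-primes field theorem and the class-level assembly with `2 ∈ S` allowed are in
`BDPRouteUpperLinksFieldAll.lean`. CONDITIONAL downstream; nothing booked; labels unchanged.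

References: [SilvermanAEC2009] VII.1 Prop. 1.3, VII.5 Prop. 5.1, App. A Prop. A.1.1;
[SilvermanATAEC1994] Cor. IV.9.2; [JetchevSkinnerWan2017] §7.4.2 (p. 31), §7.3.1 (eq:tamK).
-/

noncomputable section

open scoped Classical

open WeierstrassCurve NumberField IsDedekindDomain Literature.NumberTheory.EllipticCurves
  Rat.HeightOneSpectrum
  Literature.NumberTheory.EllipticCurves.Rank1Residual

namespace Summit.BirchSwinnertonDyer.Rank1Residual.X11b

/-- Notation (local to this file) for the explicit `R`-model `X'_c` of the twist of `X` by `1 + 4c`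
(verbatim from `QuadraticTwistLocalPolynomialTwoProofs`). -/
local notation3 "𝕋[" R ", " X ", " c "]" =>
  (⟨(WeierstrassCurve.integralModel R X).a₁,
    c * (WeierstrassCurve.integralModel R X).a₁ ^ 2 + (1 + 4 * c) * (WeierstrassCurve.integralModel R X).a₂,
    (1 + 4 * c) * (WeierstrassCurve.integralModel R X).a₃,
    2 * (1 + 4 * c) * c * (WeierstrassCurve.integralModel R X).a₁ * (WeierstrassCurve.integralModel R X).a₃ +
      (1 + 4 * c) ^ 2 * (WeierstrassCurve.integralModel R X).a₄,
    (1 + 4 * c) ^ 2 * c * (WeierstrassCurve.integralModel R X).a₃ ^ 2 +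
      (1 + 4 * c) ^ 3 * (WeierstrassCurve.integralModel R X).a₆⟩ : WeierstrassCurve R)

/-! ### `2`-adic preliminaries -/

section Two

/-- `2 ∈ 𝔪(ℤ₂)`: the residue of `2` vanishes. [folklore] -/
theorem residue_two_padicInt_two : IsLocalRing.residue ℤ_[2] 2 = 0 := by
  rw [IsLocalRing.residue_eq_zero_iff, IsLocalRing.mem_maximalIdeal, mem_nonunits_iff,
    PadicInt.isUnit_iff]
  have h : ‖((2 : ℕ) : ℤ_[2])‖ = ((2 : ℕ) : ℝ)⁻¹ := PadicInt.norm_p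
  rw [Nat.cast_ofNat] at h
  rw [h]; norm_num

/-- Over `𝔽₂ = ℤ₂/2`, `z² + z = 0` for every `z`, so an odd integer `c` is not of the form `z² + z`
modulo `2` (`c̄ ∉ ℘(𝔽₂)`). [folklore] -/
theorem not_exists_sq_add_self_eq_residue_of_odd {c : ℤ} (hc : ¬ (2 : ℤ) ∣ c) :
    ¬ ∃ z : IsLocalRing.ResidueField ℤ_[2], z ^ 2 + z = IsLocalRing.residue ℤ_[2] (c : ℤ_[2]) := by
  rintro ⟨z, hz⟩
  have h0 : z ^ 2 + z = 0 := by
    apply (PadicInt.residueField (p := 2)).injective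
    rw [map_add, map_pow, map_zero]
    generalize (PadicInt.residueField (p := 2)) z = w
    revert w; decide
  rw [h0, eq_comm, IsLocalRing.residue_eq_zero_iff, IsLocalRing.mem_maximalIdeal, mem_nonunits_iff]
    at hz
  exact hz (isUnit_intCast_padicInt_of_not_dvd (by exact_mod_cast hc))

end Two

/-! ### The unramified twist at `2` (`d_K ≡ 5 mod 8`) -/

section InertTwo

variable (W : WeierstrassCurve ℚ) [W.IsElliptic] [W.IsGloballyMinimal]
  (K : Type) [Field K] [NumberField K]
  {Wd : WeierstrassCurve ℚ} [Wd.IsElliptic] [Wd.IsGloballyMinimal] (Cd : VariableChange ℚ)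
  (hWd : Cd • W.quadraticTwist (NumberField.discr K : ℚ) = Wd)
  (h8 : NumberField.discr K % 8 = 5)

include hWd h8

/-- The common setup: with `d_K = 1 + 4c` (`c` odd), the base change of a globally minimal model of
`E^{d_K}` to `ℚ₂` is `ℚ₂`-isomorphic to the (minimal) `2`-adic twist model `X'_c` of
`X = E ⊗ ℚ₂`; both chosen minimal models are related to `X`, `X'_c` by changes of variables. We
record the consequences needed below: `ord_2` of the discriminants agree, multiplicativity passes
over, and split/non-split are exchanged. [cite: SilvermanAEC2009, VII.5 Prop. 5.1 and App. A Prop. A.1.1] -/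
theorem twist_two_of_mod_eight :
    padicValInt 2 Wd.minimalDiscriminantInt = padicValInt 2 W.minimalDiscriminantInt ∧
      (Mult W 2 → Mult Wd 2 ∧
        (Wd.HasSplitMultiplicativeReductionAtPrime 2 ↔ ¬ W.HasSplitMultiplicativeReductionAtPrime 2)) := by
  set d : ℤ := NumberField.discr K with hd_def
  have hd0 : d ≠ 0 := by rw [hd_def]; exact NumberField.discr_ne_zero K
  have hD0 : (d : ℚ) ≠ 0 := by exact_mod_cast hd0
  haveI : (W.quadraticTwist (d : ℚ)).IsElliptic := W.isElliptic_quadraticTwist hD0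
  -- `d = 1 + 4c` with `c` odd
  set c : ℤ := 2 * (d / 8) + 1 with hc_def
  have hdc : d = 1 + 4 * c := by omega
  have hcodd : ¬ (2 : ℤ) ∣ c := by omega
  have hdodd : ¬ (2 : ℤ) ∣ d := by omega
  have hk : IsLocalRing.residue ℤ_[2] 2 = 0 := residue_two_padicInt_two
  haveI := finite_residueField_padicInt 2
  have hAS := not_exists_sq_add_self_eq_residue_of_odd hcodd
  -- the curves over `ℚ₂`
  set X : WeierstrassCurve ℚ_[2] := W.baseChange ℚ_[2] with hX
  set Y : WeierstrassCurve ℚ_[2] := Wd.baseChange ℚ_[2] with hY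
  haveI : X.IsElliptic := inferInstanceAs (W.map (algebraMap ℚ ℚ_[2])).IsElliptic
  haveI hXmin : X.IsMinimal ℤ_[2] := isMinimal_map_padic_of_isGloballyMinimal W 2
  haveI hYmin : Y.IsMinimal ℤ_[2] := isMinimal_map_padic_of_isGloballyMinimal Wd 2
  haveI hTmin : ((𝕋[ℤ_[2], X, (c : ℤ_[2])]).baseChange ℚ_[2]).IsMinimal ℤ_[2] :=
    isMinimal_baseChange_twistLiftTwo ℤ_[2] hk X (c : ℤ_[2])
  set T : WeierstrassCurve ℚ_[2] := (𝕋[ℤ_[2], X, (c : ℤ_[2])]).baseChange ℚ_[2] with hT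
  have hdalg : algebraMap ℤ_[2] ℚ_[2] (1 + 4 * (c : ℤ_[2])) = algebraMap ℚ ℚ_[2] (d : ℚ) := by
    rw [map_add, map_one, map_mul, map_ofNat, map_intCast, map_intCast, hdc]
    push_cast
    ring
  have hX0 : X.Δ ≠ 0 := by
    rw [hX, baseChange, map_Δ, ← cast_minimalDiscriminantInt W, map_intCast]
    exact_mod_cast minimalDiscriminantInt_ne_zero W
  have hTΔ : T.Δ = algebraMap ℤ_[2] ℚ_[2] (1 + 4 * (c : ℤ_[2])) ^ 6 * X.Δ :=
    Δ_baseChange_twistLiftTwo ℤ_[2] X (c : ℤ_[2])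
  have hT0 : T.Δ ≠ 0 := by
    rw [hTΔ, hdalg]
    exact mul_ne_zero (pow_ne_zero 6 ((map_ne_zero _).mpr hD0)) hX0
  -- `Y = C' • T`
  obtain ⟨D, hD⟩ := exists_baseChange_twistLiftTwo_eq_smul (R := ℤ_[2]) X (c : ℤ_[2])
  have hYT : Y = (Cd.map (algebraMap ℚ ℚ_[2]) * D⁻¹) • T := by
    rw [hY, ← hWd, WeierstrassCurve.VariableChange.baseChange_smul_eq (W.quadraticTwist (d : ℚ)) Cd
      ℚ_[2], baseChange, map_quadraticTwist, ← hdalg, mul_smul, hT, hD, inv_smul_smul, hX, baseChange]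
  -- the chosen minimal models
  obtain ⟨C₁, hC₁⟩ : ∃ C : VariableChange ℚ_[2], X.minimal ℤ_[2] = C • X := ⟨_, rfl⟩
  obtain ⟨C₂, hC₂⟩ : ∃ C : VariableChange ℚ_[2], Y.minimal ℤ_[2] = C • Y := ⟨_, rfl⟩
  have hC₂' : Y.minimal ℤ_[2] = (C₂ * (Cd.map (algebraMap ℚ ℚ_[2]) * D⁻¹)) • T := by
    rw [hC₂, hYT, smul_smul]
  refine ⟨?_, fun hmult ↦ ?_⟩
  · -- discriminants
    have hmv : Padic.mulValuation Y.Δ = Padic.mulValuation T.Δ := by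
      rw [hYT]
      exact padicMulValuation_Δ_smul_eq_of_isMinimal T _ hTmin (by rw [← hYT]; exact hYmin)
    have hXΔ : X.Δ = (W.minimalDiscriminantInt : ℚ_[2]) := by
      rw [hX, baseChange, map_Δ, ← cast_minimalDiscriminantInt W, map_intCast]
    have hYΔ : Y.Δ = (Wd.minimalDiscriminantInt : ℚ_[2]) := by
      rw [hY, baseChange, map_Δ, ← cast_minimalDiscriminantInt Wd, map_intCast]
    have hTΔ' : T.Δ = ((d ^ 6 * W.minimalDiscriminantInt : ℤ) : ℚ_[2]) := by
      rw [hTΔ, hdalg, hXΔ]; push_cast; simp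
    have hY0 : Y.Δ ≠ 0 := by rw [hYΔ]; exact_mod_cast minimalDiscriminantInt_ne_zero Wd
    rw [padicMulValuation_apply_of_ne_zero hY0, padicMulValuation_apply_of_ne_zero hT0,
      WithZero.exp_inj, neg_inj, hYΔ, hTΔ', Padic.valuation_intCast, Padic.valuation_intCast] at hmv
    have hmv' : padicValInt 2 Wd.minimalDiscriminantInt =
        padicValInt 2 (d ^ 6 * W.minimalDiscriminantInt) := by exact_mod_cast hmv
    have h6 : padicValInt 2 (d ^ 6) = 0 :=
      padicValInt.eq_zero_of_not_dvd fun h ↦ hdodd (Int.Prime.dvd_pow' Nat.prime_two h)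
    rw [hmv', padicValInt.mul (pow_ne_zero 6 hd0) (minimalDiscriminantInt_ne_zero W), h6, zero_add]
  · -- multiplicativity and the split/non-split exchange
    have hXmult : X.HasMultiplicativeReduction ℤ_[2] :=
      (hasMultiplicativeReduction_iff_of_isMinimal_of_eq_smul ℤ_[2] hC₁ hX0).mp hmult
    have hTmult : T.HasMultiplicativeReduction ℤ_[2] :=
      (hasMultiplicativeReduction_twistLiftTwo_iff ℤ_[2] hk).mpr hXmult
    have hYmult : Mult Wd 2 :=
      (hasMultiplicativeReduction_iff_of_isMinimal_of_eq_smul ℤ_[2] hC₂' hT0).mpr hTmult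
    refine ⟨hYmult, ?_⟩
    have hsplit : T.HasSplitMultiplicativeReduction ℤ_[2] ↔ ¬ X.HasSplitMultiplicativeReduction ℤ_[2] := by
      rw [hT, hasSplitMultiplicativeReduction_twistLiftTwo_iff ℤ_[2] hk hXmult]
      constructor
      · intro h hXs; exact hAS (h.mpr hXs)
      · intro h; exact ⟨fun hs ↦ absurd hs hAS, fun hs ↦ absurd hs h⟩
    have hXs_iff : W.HasSplitMultiplicativeReductionAtPrime 2 ↔ X.HasSplitMultiplicativeReduction ℤ_[2] :=
      hasSplitMultiplicativeReduction_iff_of_isMinimal_of_eq_smul ℤ_[2] hC₁ hX0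
    have hYs_iff : Wd.HasSplitMultiplicativeReductionAtPrime 2 ↔ T.HasSplitMultiplicativeReduction ℤ_[2] :=
      hasSplitMultiplicativeReduction_iff_of_isMinimal_of_eq_smul ℤ_[2] hC₂' hT0
    rw [hYs_iff, hsplit, hXs_iff]

/-- **`ord_2 Δ_min(E^{d_K}) = ord_2 Δ_min(E)` when `d_K ≡ 5 (mod 8)`** (twist unramified at `2`).
[cite: SilvermanAEC2009, VII.1 Prop. 1.3(b) and App. A Prop. A.1.1] -/
theorem padicValInt_minimalDiscriminantInt_twist_eq_of_mod_eight :
    padicValInt 2 Wd.minimalDiscriminantInt = padicValInt 2 W.minimalDiscriminantInt :=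
  (twist_two_of_mod_eight W K Cd hWd h8).1

/-- **Multiplicative reduction at `2` survives the twist by `d_K ≡ 5 (mod 8)`.**
[cite: SilvermanAEC2009, VII.5 Prop. 5.1(b)] -/
theorem mult_twist_of_mod_eight (hmult : Mult W 2) :
    Mult Wd 2 :=
  ((twist_two_of_mod_eight W K Cd hWd h8).2 hmult).1

/-- **At `2` inert (`d_K ≡ 5 mod 8`) and multiplicative, the two Tamagawa exponents add up to at most
`ord_p(ord_2 Δ_min(E))`** (`p ≥ 5`): exactly one of `E`, `E^{d_K}` is split multiplicative at `2`, both
with `ord_2 Δ_min(E)` (Kodaira–Néron IV.9.2(d)); the other has `c_2 ≤ 4`. The `ℓ = 2` companion of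
`padicValNat_localTamagawaNumber_add_twist_le_of_inert`. [cite: SilvermanATAEC1994, Cor. IV.9.2(d) with (b) (PDF p. 340)]
[cite: SilvermanAEC2009, VII.5 Prop. 5.1(b) and App. A Prop. A.1.1] -/
theorem padicValNat_localTamagawaNumber_add_twist_le_of_inert_two (p : ℕ) [Fact p.Prime]
    (hp5 : 5 ≤ p) (hmult : Mult W 2) :
    padicValNat p ((W.baseChange ℚ_[2]).localTamagawaNumber ℤ_[2]) +
        padicValNat p ((Wd.baseChange ℚ_[2]).localTamagawaNumber ℤ_[2]) ≤
      padicValNat p (padicValInt 2 W.minimalDiscriminantInt) := by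
  haveI : (W.baseChange ℚ_[2]).IsElliptic := inferInstanceAs (W.map (algebraMap ℚ ℚ_[2])).IsElliptic
  haveI : (Wd.baseChange ℚ_[2]).IsElliptic := inferInstanceAs (Wd.map (algebraMap ℚ ℚ_[2])).IsElliptic
  obtain ⟨hΔ, h⟩ := twist_two_of_mod_eight W K Cd hWd h8
  obtain ⟨-, hswap⟩ := h hmult
  obtain ⟨v, hv⟩ : ∃ v : HeightOneSpectrum ℤ, (primesEquiv v : ℕ) = 2 :=
    ⟨primesEquiv.symm ⟨2, Nat.prime_two⟩, by rw [Equiv.apply_symm_apply]⟩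
  by_cases hWs : W.HasSplitMultiplicativeReductionAtPrime 2
  · have hWdns : ¬ ((Wd.baseChange ℚ_[2]).minimal ℤ_[2]).HasSplitMultiplicativeReduction ℤ_[2] :=
      fun hs ↦ (hswap.mp hs) hWs
    have h4 := localTamagawaNumber_padic_le_four 2 (Wd.baseChange ℚ_[2]) hWdns
    have hne := localTamagawaNumber_padic_ne_zero_holds 2 (Wd.baseChange ℚ_[2])
    have h0 : padicValNat p ((Wd.baseChange ℚ_[2]).localTamagawaNumber ℤ_[2]) = 0 := by
      rw [padicValNat.eq_zero_of_not_dvd]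
      intro hdvd
      have := Nat.le_of_dvd (Nat.pos_of_ne_zero hne) hdvd
      omega
    rw [h0, add_zero, localTamagawaNumber_eq_padicValInt_of_split W v hv hWs]
  · have hWds : Wd.HasSplitMultiplicativeReductionAtPrime 2 := hswap.mpr hWs
    have h4 := localTamagawaNumber_padic_le_four 2 (W.baseChange ℚ_[2]) hWs
    have hne := localTamagawaNumber_padic_ne_zero_holds 2 (W.baseChange ℚ_[2])
    have h0 : padicValNat p ((W.baseChange ℚ_[2]).localTamagawaNumber ℤ_[2]) = 0 := by
      rw [padicValNat.eq_zero_of_not_dvd]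
      intro hdvd
      have := Nat.le_of_dvd (Nat.pos_of_ne_zero hne) hdvd
      omega
    rw [h0, zero_add, localTamagawaNumber_eq_padicValInt_of_split Wd v hv hWds, hΔ]

/-- **A (ram) witness at `2` passes to the twist when `2` is inert** (`d_K ≡ 5 mod 8`): `2 ≠ p`
multiplicative with `p ∤ ord_2 Δ_min(E)` ⟹ `Ram E^{d_K} p` with the witness `2`. [folklore] -/
theorem ram_twist_of_inert_witness_two (p : ℕ) [Fact p.Prime] (h2p : 2 ≠ p)
    (hmult : Mult W 2)
    (hv : ¬ p ∣ padicValInt 2 W.minimalDiscriminantInt) : Ram Wd p := by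
  refine ⟨2, inferInstance, h2p, mult_twist_of_mod_eight W K Cd hWd h8 hmult, ?_⟩
  rwa [padicValInt_minimalDiscriminantInt_twist_eq_of_mod_eight W K Cd hWd h8]

end InertTwo

end Summit.BirchSwinnertonDyer.Rank1Residual.X11b

end
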